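import Literature.Geometry.Kaehler.ManifoldFormsPullback
import Literature.Geometry.Kaehler.LocalFormsGlue
import Literature.NumberTheory.Transcendental.DolbeaultIntegrabilityProofs
import Literature.NumberTheory.Transcendental.DolbeaultFunSmulProofs
import Literature.Analysis.Complex.DolbeaultInvariance
import Mathlib.Geometry.Manifold.PartitionOfUnity
import HarnessLib

/-!
# Extending an `F^p` closed form from a fibre to a tube: the form `Ξ` of Griffiths' computation

Topic: Hodge theory in families (Voisin (2002), §10.2.2, proof of Thm. 10.9). Theorems only, no
new facts.

Let `T` be a complex manifold, `ι : M → T` a holomorphic map from a compact complex manifold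
(the fibre), `W ⊇ ι(M)` open and `ρ : T → M` a retraction of the tube, `C^∞` on `W` with
`ρ ∘ ι = id` (from an Ehresmann trivialisation). Let `m` be a smooth CLOSED `k`-form on `M` lying
in `F^p` (all `(r,s)`-components with `r < p` vanish; e.g. the harmonic representative of a class
of `F^pH^k`). Then (`exists_tubeExtension`) there is a smooth `k`-form `Ξ` on `T` with

* `ι^*Ξ = 0`;
* `dΞ ∈ F^p` at the points of the fibre: `((dΞ)(ι x))^{r,s} = 0` for `r < p`;
* `Ξ = Π^{<p}(ρ^*m)` on an open `W₁`, `ι(M) ⊆ W₁ ⊆ W`.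

Construction: `m̃ = χ • ρ^*m` with `χ` a smooth cut-off, `χ = 1` near `ι(M)`, supported in `W`
(a global smooth form), and `Ξ = Π^{<p} m̃ = ∑_{r<p} m̃^{r,k-r}`. Then `ι^*Ξ = Π^{<p}(ι^*m̃) =
Π^{<p} m = 0` (type components commute with holomorphic pull-back, `typeComponent_pullback`);
and at a point of the fibre `dΞ = dm̃ - d(Π^{≥p} m̃)` with `dm̃ = ρ^*(dm) = 0` there (`m̃ = ρ^*m`
near the fibre; pointwise naturality `mextDeriv_pullback_apply`) while `d` of a form of pure type
`(r,s)`, `r ≥ p`, has only components `(r+1,s)`, `(r,s+1)`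
(`IsOfType.typeComponent_mextDeriv_eq_zero`). These are exactly the two hypotheses on `Ξ` of
`differentiableAt_complex_cintegral_wedge_pullback_family`
(`HodgeTheory/PeriodIntegralHolomorphic`): in Voisin's proof, `Ξ` restricted to the nearby
fibres is the `F^{<p}`-part of the transported representative, whose integral against a test form
is differentiated.

## References

* C. Voisin, *Hodge Theory and Complex Algebraic Geometry I*, CUP (2002), §10.2.2 (proof of
  Thm. 10.9), §9.1.2 (Ehresmann). [VoisinHodgeI2002]
-/

noncomputable section

open scoped Manifold ContDiff Topology
open Set Function Filter Finset Complex
open Literature.Geometry.Kaehler Literature.NumberTheory.Transcendental Literature.Analysis.Complex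

namespace Literature.AlgebraicGeometry.HodgeTheory

-- `TangentSpace 𝓘(ℝ, E) x = E` is used silently, as in the tree's form files.
set_option backward.isDefEq.respectTransparency false

variable {ET : Type*} [NormedAddCommGroup ET] [NormedSpace ℂ ET] [FiniteDimensional ℂ ET]
  {T : Type*} [TopologicalSpace T] [ChartedSpace ET T] [IsManifold 𝓘(ℝ, ET) ∞ T]
  [IsManifold 𝓘(ℂ, ET) ω T] [T2Space T] [NormalSpace T] [SigmaCompactSpace T]
  {EM : Type*} [NormedAddCommGroup EM] [NormedSpace ℂ EM] [FiniteDimensional ℂ EM]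
  {M : Type*} [TopologicalSpace M] [ChartedSpace EM M] [IsManifold 𝓘(ℝ, EM) ∞ M]
  [IsManifold 𝓘(ℂ, EM) ω M] [CompactSpace M]

/-! ### Auxiliary pointwise facts -/

omit [FiniteDimensional ℂ ET] [IsManifold 𝓘(ℝ, ET) ∞ T] [IsManifold 𝓘(ℂ, ET) ω T] [T2Space T]
  [NormalSpace T] [SigmaCompactSpace T] [FiniteDimensional ℂ EM] [IsManifold 𝓘(ℝ, EM) ∞ M]
  [IsManifold 𝓘(ℂ, EM) ω M] [CompactSpace M] in
/-- Pointwise functoriality of the pull-back: `(ι^*(ρ^*m)) x = ((ρ ∘ ι)^* m) x` when `ρ` is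
differentiable at `ι x` and `ι` at `x` (chain rule). [folklore] -/
theorem pullback_pullback_apply {ρ : T → M} {ι : M → T} {k : ℕ} (m : MForm 𝓘(ℝ, EM) M ℂ k)
    {x : M} (hρ : MDifferentiableAt 𝓘(ℝ, ET) 𝓘(ℝ, EM) ρ (ι x))
    (hι : MDifferentiableAt 𝓘(ℝ, EM) 𝓘(ℝ, ET) ι x) :
    (m.pullback 𝓘(ℝ, ET) ρ).pullback 𝓘(ℝ, EM) ι x = m.pullback 𝓘(ℝ, EM) (ρ ∘ ι) x := by
  ext v
  simp only [MForm.pullback_apply, Function.comp_apply, mfderiv_comp x hρ hι,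
    ContinuousLinearMap.coe_comp]

omit [FiniteDimensional ℂ ET] [IsManifold 𝓘(ℝ, ET) ∞ T] [IsManifold 𝓘(ℂ, ET) ω T] [T2Space T]
  [NormalSpace T] [SigmaCompactSpace T] [FiniteDimensional ℂ EM] [IsManifold 𝓘(ℝ, EM) ∞ M]
  [IsManifold 𝓘(ℂ, EM) ω M] [CompactSpace M] in
/-- A pull-back along a map equal to the identity is the form itself, pointwise. [folklore] -/
theorem pullback_apply_of_eq_id {f : M → M} (hf : f = id) {k : ℕ} (m : MForm 𝓘(ℝ, EM) M ℂ k)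
    (x : M) : m.pullback 𝓘(ℝ, EM) f x = m x := by
  subst hf
  rw [MForm.pullback_id]

omit [FiniteDimensional ℂ ET] [IsManifold 𝓘(ℝ, ET) ∞ T] [IsManifold 𝓘(ℂ, ET) ω T] [T2Space T]
  [NormalSpace T] [SigmaCompactSpace T] in
/-- The `(p,q)`-component of a finite sum of forms is the sum of the components. [folklore] -/
theorem typeComponent_finset_sum {κ : Type*} {k : ℕ} (S : Finset κ)
    (f : κ → MForm 𝓘(ℝ, ET) T ℂ k) (p q : ℕ) :
    (∑ i ∈ S, f i).typeComponent p q = ∑ i ∈ S, (f i).typeComponent p q := by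
  classical
  induction S using Finset.induction_on with
  | empty => simp [MForm.typeComponent_zero]
  | insert a S ha ih => rw [Finset.sum_insert ha, Finset.sum_insert ha, MForm.typeComponent_add, ih]

/-! ### The extension -/

/-- **Extension of an `F^p` closed form from a fibre to a tube** (the form `Ξ` of Griffiths'
computation, Voisin (2002), §10.2.2): see the module docstring.
[cite: VoisinHodgeI2002, §10.2.2 (proof of Thm. 10.9)] -/
theorem exists_tubeExtension {ι : M → T} (hι : MDifferentiable 𝓘(ℂ, EM) 𝓘(ℂ, ET) ι)
    {W : Set T} (hW : IsOpen W) (hιW : range ι ⊆ W) {ρ : T → M}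
    (hρ : ∀ y ∈ W, ContMDiffAt 𝓘(ℝ, ET) 𝓘(ℝ, EM) ∞ ρ y) (hρι : ∀ x, ρ (ι x) = x)
    {k p : ℕ} {m : MForm 𝓘(ℝ, EM) M ℂ k} (hm : IsSmoothForm m) (hmc : IsClosedForm m)
    (hmF : ∀ r s, r < p → m.typeComponent r s = 0) :
    ∃ Ξ : MForm 𝓘(ℝ, ET) T ℂ k, IsSmoothForm Ξ ∧ Ξ.pullback 𝓘(ℝ, EM) ι = 0 ∧
      (∀ x r s, r < p → typeProjAt (E := ET) r s (mextDeriv Ξ (ι x)) = 0) ∧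
      ∃ W₁ : Set T, IsOpen W₁ ∧ range ι ⊆ W₁ ∧ W₁ ⊆ W ∧
        ∀ y ∈ W₁, Ξ y = ∑ pq ∈ (antidiagonal k).filter (fun pq ↦ pq.1 < p),
          (m.pullback 𝓘(ℝ, ET) ρ).typeComponent pq.1 pq.2 y := by
  classical
  haveI : LocallyCompactSpace T := ChartedSpace.locallyCompactSpace ET T
  have hιr : ContMDiff 𝓘(ℝ, EM) 𝓘(ℝ, ET) ∞ ι := hι.contMDiff_real_of_complex
  have hιc : Continuous ι := hιr.continuous
  -- the compact fibre `K = ι(M)` and an open `W' ⊇ K` with compact closure inside `W`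
  set K : Set T := range ι with hK
  have hKc : IsCompact K := isCompact_range hιc
  obtain ⟨W', hW'o, hKW', hW'W, -⟩ := exists_open_between_and_isCompact_closure hKc hW hιW
  -- the cut-off `χ`: `1` near `K`, `0` outside `closure W'`
  obtain ⟨χ, hχ1, hχ0, -⟩ := exists_contMDiffMap_one_nhds_of_subset_interior 𝓘(ℝ, ET)
    (n := (⊤ : ℕ∞)) hKc.isClosed (t := closure W')
    (hKW'.trans (hW'o.subset_interior_iff.2 subset_closure))
  have hχs : ContMDiff 𝓘(ℝ, ET) 𝓘(ℝ) ∞ χ := χ.contMDiff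
  have hχsupp : tsupport χ ⊆ W := by
    refine (closure_minimal (fun y hy ↦ ?_) isClosed_closure).trans hW'W
    by_contra h
    exact hy (hχ0 y h)
  -- the global smooth form `m̃ = χ • ρ^*m`
  set mt : MForm 𝓘(ℝ, ET) T ℂ k := (χ : T → ℝ) • m.pullback 𝓘(ℝ, ET) ρ with hmt
  have hρev : ∀ y ∈ W, ∀ᶠ z in 𝓝 y, ContMDiffAt 𝓘(ℝ, ET) 𝓘(ℝ, EM) ∞ ρ z := fun y hy ↦
    Filter.eventually_of_mem (hW.mem_nhds hy) fun z hz ↦ hρ z hz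
  have hpull_smoothAt : ∀ y ∈ W, (m.pullback 𝓘(ℝ, ET) ρ).SmoothAt y := fun y hy ↦
    MForm.SmoothAt.pullback (hρev y hy) (hm (ρ y))
  have hmts : IsSmoothForm mt := by
    intro y
    by_cases hy : y ∈ W
    · exact MForm.SmoothAt.fun_smul (hχs y) (hpull_smoothAt y hy)
    · -- outside `W`, hence outside `tsupport χ`: `mt = 0` near `y`
      have hy' : y ∉ tsupport χ := fun h ↦ hy (hχsupp h)
      have hev : ∀ᶠ z in 𝓝 y, (0 : MForm 𝓘(ℝ, ET) T ℂ k) z = mt z := by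
        have : ∀ᶠ z in 𝓝 y, χ z = 0 :=
          (notMem_tsupport_iff_eventuallyEq.1 hy').mono fun z hz ↦ hz
        filter_upwards [this] with z hz
        change (0 : ET [⋀^Fin k]→L[ℝ] ℂ) = χ z • (m.pullback 𝓘(ℝ, ET) ρ) z
        rw [hz, zero_smul]
      exact (MForm.smoothAt_zero y).congr_of_eventuallyEq hev
  -- `Ξ = Π^{<p} m̃`, `F = Π^{≥p} m̃`, `Ξ + F = m̃`
  set S₁ := (antidiagonal k).filter (fun pq ↦ pq.1 < p) with hS₁
  set S₂ := (antidiagonal k).filter (fun pq ↦ ¬ pq.1 < p) with hS₂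
  set Ξ : MForm 𝓘(ℝ, ET) T ℂ k := ∑ pq ∈ S₁, mt.typeComponent pq.1 pq.2 with hΞ
  set F : MForm 𝓘(ℝ, ET) T ℂ k := ∑ pq ∈ S₂, mt.typeComponent pq.1 pq.2 with hF
  have hsum : Ξ + F = mt := by
    rw [hΞ, hF, hS₁, hS₂, Finset.sum_filter_add_sum_filter_not]
    exact sum_antidiagonal_typeComponent_holds mt
  have hcomp_smooth : ∀ pq : ℕ × ℕ, IsSmoothForm (mt.typeComponent pq.1 pq.2) :=
    fun pq ↦ hmts.typeComponent pq.1 pq.2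
  have hΞs : IsSmoothForm Ξ :=
    (smoothForms 𝓘(ℝ, ET) T ℂ k).sum_mem fun pq _ ↦ hcomp_smooth pq
  have hFs : IsSmoothForm F :=
    (smoothForms 𝓘(ℝ, ET) T ℂ k).sum_mem fun pq _ ↦ hcomp_smooth pq
  -- the open `W₁` where `χ = 1`
  obtain ⟨U₁, hU₁o, hKU₁, hU₁⟩ : ∃ U₁ : Set T, IsOpen U₁ ∧ K ⊆ U₁ ∧ ∀ y ∈ U₁, χ y = 1 := by
    obtain ⟨U₁, hU₁o, hKU₁, h⟩ := mem_nhdsSet_iff_exists.1 hχ1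
    exact ⟨U₁, hU₁o, hKU₁, fun y hy ↦ h hy⟩
  set W₁ : Set T := U₁ ∩ W with hW₁
  have hW₁o : IsOpen W₁ := hU₁o.inter hW
  have hKW₁ : K ⊆ W₁ := subset_inter hKU₁ hιW
  have hmt_eq : ∀ y ∈ W₁, ∀ᶠ z in 𝓝 y, mt z = m.pullback 𝓘(ℝ, ET) ρ z := by
    intro y hy
    filter_upwards [hU₁o.mem_nhds hy.1] with z hz
    change χ z • (m.pullback 𝓘(ℝ, ET) ρ) z = _
    rw [hU₁ z hz, one_smul]
  refine ⟨Ξ, hΞs, ?_, ?_, W₁, hW₁o, hKW₁, inter_subset_right, ?_⟩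
  · /- `ι^*Ξ = Π^{<p}(ι^* m̃) = Π^{<p} m = 0` -/
    have hιmt : mt.pullback 𝓘(ℝ, EM) ι = m := by
      funext x
      have hx : ι x ∈ W := hιW ⟨x, rfl⟩
      have h1 : mt.pullback 𝓘(ℝ, EM) ι x =
          (χ (ι x) : ℝ) • (m.pullback 𝓘(ℝ, ET) ρ).pullback 𝓘(ℝ, EM) ι x := by
        ext v
        simp only [MForm.pullback_apply]
        rfl
      rw [h1, hU₁ _ (hKU₁ ⟨x, rfl⟩), one_smul,
        pullback_pullback_apply m ((hρ _ hx).mdifferentiableAt (by simp))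
          ((hιr x).mdifferentiableAt (by simp)),
        pullback_apply_of_eq_id (show ρ ∘ ι = id from funext hρι) m x]
    calc Ξ.pullback 𝓘(ℝ, EM) ι
        = ∑ pq ∈ S₁, (mt.typeComponent pq.1 pq.2).pullback 𝓘(ℝ, EM) ι := by
          rw [hΞ]; exact map_sum (MForm.pullbackₗ 𝓘(ℝ, EM) ι k) _ _
      _ = ∑ pq ∈ S₁, m.typeComponent pq.1 pq.2 := by
          refine Finset.sum_congr rfl fun pq _ ↦ ?_
          rw [← typeComponent_pullback pq.1 pq.2 mt hι, hιmt]
      _ = 0 := Finset.sum_eq_zero fun pq hpq ↦ hmF _ _ (Finset.mem_filter.1 hpq).2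
  · /- `dΞ ∈ F^p` at the points of the fibre -/
    intro x r s hr
    have hx : ι x ∈ W₁ := hKW₁ ⟨x, rfl⟩
    -- `dΞ + dF = d m̃`
    have hdΞ : mextDeriv Ξ + mextDeriv F = mextDeriv mt := by
      rw [← mextDeriv_add hΞs hFs, hsum]
    -- `d m̃ (ι x) = ρ^*(dm) (ι x) = 0`
    have hdmt : mextDeriv mt (ι x) = 0 := by
      have h1 : mextDeriv mt (ι x) = mextDeriv (m.pullback 𝓘(ℝ, ET) ρ) (ι x) :=
        mextDeriv_congr_of_eventuallyEq (hmt_eq _ hx)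
      rw [h1, mextDeriv_pullback_apply (hρev _ hx.2) (hm _)]
      have h2 : mextDeriv m = 0 := hmc
      rw [h2, MForm.pullback_zero]
      rfl
    -- `(dF)^{r,s} = 0` for `r < p`: `F` is a sum of pure types `(a,b)` with `a ≥ p`
    have hdFc : ∀ pq ∈ S₂, (mextDeriv (mt.typeComponent pq.1 pq.2)).typeComponent r s = 0 := by
      intro pq hpq
      obtain ⟨hpq, hge⟩ := Finset.mem_filter.1 hpq
      rw [mem_antidiagonal] at hpq
      have htype : IsOfType pq.1 pq.2 (mt.typeComponent pq.1 pq.2) :=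
        isOfType_typeComponent_holds hpq mt
      refine htype.typeComponent_mextDeriv_eq_zero (hcomp_smooth pq) ?_ ?_
      · intro h; rw [Prod.mk.injEq] at h; omega
      · intro h; rw [Prod.mk.injEq] at h; omega
    have hdF : (mextDeriv F).typeComponent r s = 0 := by
      rw [hF, mextDeriv_sum _ _ fun pq _ ↦ hcomp_smooth pq, typeComponent_finset_sum]
      exact Finset.sum_eq_zero hdFc
    -- hence `(dΞ)^{r,s} = (d m̃)^{r,s}`, which vanishes at `ι x`
    have hΞc : (mextDeriv Ξ).typeComponent r s = (mextDeriv mt).typeComponent r s := by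
      rw [← hdΞ, MForm.typeComponent_add, hdF, add_zero]
    have h0 : (mextDeriv mt).typeComponent r s (ι x) = 0 := by
      rw [typeComponent_apply_eq_typeProjAt, hdmt]
      exact typeProjAt_zero (E := ET) (k := k + 1) r s
    have h1 := typeComponent_apply_eq_typeProjAt r s (mextDeriv Ξ) (ι x)
    rw [hΞc, h0] at h1
    exact h1.symm
  · intro y hy
    rw [hΞ, Finset.sum_apply]
    refine Finset.sum_congr rfl fun pq _ ↦ ?_
    rw [typeComponent_apply_eq_typeProjAt, typeComponent_apply_eq_typeProjAt]
    congr 1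
    exact (hmt_eq y hy).self_of_nhds

end Literature.AlgebraicGeometry.HodgeTheory
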